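import Summits.BirchSwinnertonDyer.BirchSwinnertonDyer.Theorems.ByReductionTypeAtTwoTorsionEulerCharH46LayerSelmer
import Summits.BirchSwinnertonDyer.BirchSwinnertonDyer.Theorems.ByReductionTypeAtTwoTorsionEulerCharH46SplitAuxPrime
import Summits.BirchSwinnertonDyer.BirchSwinnertonDyer.Theorems.ByReductionTypeAtTwoTorsionEulerCharB6Schedule
import Summits.BirchSwinnertonDyer.BirchSwinnertonDyer.Theorems.ByReductionTypeAtTwoTorsionEulerCharH46OfT1
import HarnessLib

set_option linter.dupNamespace false -- `…BirchSwinnertonDyer.BirchSwinnertonDyer…` is the cell's nested layout (D-0017)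
set_option autoImplicit false

/-!
# H46 kernel programme (road C′), brick R5 of `NOTE-B6-SCHEDULE-GEN38` §4 — THE GLUE: Greenberg's Lemma 4.6 at one auxiliary place
# `H46(W, p, κ, v₀)` WITHOUT the side condition (T₁); Greenberg's Thm. 4.1 display at EVERY good ordinary `p`;
# `X5.O1.TwoAdicEulerCharRankZero W 0` for EVERY `W`

Cell `bsd-2adic` (run/shared/lean/pub/bsd-2adic/), seat `bsd-2adic-tower-1` GEN 39; `--supports stmt-BirchSwinnertonDyer-19271`
(helper, item `OrdKatoHalfAtTwo`, TOWER road). THEOREMS ONLY (no definition, no named fact, no instance, no `sorry`); closes no item;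
nothing booked; BSD is not proved by any of this.

GEN 35's glue `H46LevelZero.lemma46At_of_T1` ran the assembly `H46Assembly.exists_realiser_of_sockets` at the layer `n = 0`, where the
socket (HB6) needs (T₁) `E(ℚ)[p^∞] ∩ E₁(ℚ_p) = 0`. Here the assembly runs at the deep layer `n*` of the B6 schedule
(`TorsionEulerChar.B6.exists_layer_cores_reduce_eq_zero`, GEN 38: `∃ n* ∀ c' ∃ c …`), with

* `Sp := S` — at `v ∋ p` Greenberg's STRICT condition (`H46AtP`, GEN 35), at the other places of `S` the UNRAMIFIED condition on both
  sides (`H46BadPlaces`, R1): `Lp v = if p ∈ v then (strict) else H¹_ur`, `Λp v b = (p ∈ v → b strict) ∧ (p ∉ v → loc_v (Sh b) unramified)`;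
* the auxiliary place `v₀ ∉ S` SPLIT in `ℚ_{n*}` (`H46SplitAuxPrime`, R4: Dirichlet prime `ℓ ≡ 1 (mod p^{n*+2})`);
* (HB6) := B6a (`H46Obstruction.canonical_cupProduct_incl_eq_zero_of_cores_reduce_eq_zero`) ∘ the schedule, whose Selmer hypothesis
  `p^{c'} · h_{n*}(push b) ∈ Sel_∞` is R2 (`H46LayerSelmer.exists_pow_nsmul_push_mem_selmerInfty`);

and the quantifiers in the order `n*` (schedule) → `S` → `v₀` (split in `ℚ_{n*}`) → `c'` (R2, depends on `v₀`) → `c` (schedule) → per class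
`z`: `j` (`p^j z = 0`), `N = c + j + 1`.

* `exists_place_natCast_mem` — plumbing: a place of `ℚ` above `p`.
* **`exists_lemma46`** — `W/ℚ` globally minimal elliptic, good ORDINARY at `p`, `κ` cyclotomic, `Sel_{p^∞}(E/ℚ)` finite: there is a good
  place `v₀ ∤ p` with `H46(W, p, κ, v₀)` — every `p`-power-torsion class of `H¹(Γ_{ℚ_{v₀}}, E(ℚ̄_{v₀}))` is the restriction at `v₀` of every
  conjugate of a class `T ∈ H¹(ℚ_∞, E[p^∞])` Kummer at all `v ≠ v₀` and at `∞`. NO (T₁), no hypothesis on `E(ℚ)[p]`.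
* **`charValue_rankZero`** — Greenberg's Thm. 4.1 display in `ℚ_p` for EVERY good ordinary `p` (`2` included), ANY rational `p`-torsion:
  `fE(0) · #E(ℚ)(p)² = u · p^{ord_p ∏ c_ℓ} · #Ẽ(𝔽_p)(p)² · #Sel_{p^∞}(E/ℚ)` (`charValue_rankZero_of_lemma46` ∘ `exists_lemma46`).
* **`twoAdicEulerCharRankZero`** — `X5.O1.TwoAdicEulerCharRankZero W 0` for EVERY globally minimal elliptic `W/ℚ`: the PRINT binder `hEC` of
  the K4 TOWER doors is a theorem (`twoAdicEulerCharRankZero_of_lemma46` ∘ `exists_lemma46`).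

References: [GreenbergLNM1716] Thm. 4.1 (p. 102), §4 Lemma 4.6 (p. 105), Lemma 4.7 (p. 108), Prop. 4.13; [MilneADT2006] I Thm. 4.10, 2.6,
Cor. 2.3; [NeukirchSchmidtWingberg2008] I §6 (1.6.4); [Washington1997] §13.1.
-/

noncomputable section

open scoped Classical NumberField ContRepresentation

namespace Summit.BirchSwinnertonDyer.BirchSwinnertonDyer.Theorems

namespace TorsionEulerChar.H46

open CategoryTheory Field NumberField IsDedekindDomain WeierstrassCurve
  Literature.NumberTheory.EllipticCurves Literature.NumberTheory.EllipticCurves.CyclotomicLayer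
  Literature.NumberTheory.EllipticCurves.GreenbergSelmer
  Literature.NumberTheory.GaloisRepresentations Literature.NumberTheory.GaloisRepresentations.DiscreteGaloisModule
  Literature.NumberTheory.GaloisCohomology ZpExtension
open _root_.TopRep _root_.ContinuousCohomology
open Literature.Algebra.Homology.DiscreteRep (toTopRepHom)

/-- A place of `ℚ` above the rational prime `p` exists (plumbing). [folklore] -/
theorem exists_place_natCast_mem (p : ℕ) [hp : Fact p.Prime] : ∃ vp : HeightOneSpectrum (𝓞 ℚ), ((p : ℕ) : 𝓞 ℚ) ∈ vp.asIdeal := by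
  have hne : Ideal.span {((p : ℕ) : 𝓞 ℚ)} ≠ ⊤ := by
    rw [Ne, Ideal.span_singleton_eq_top]
    intro hu
    have h := hu.map (Rat.IsIntegralClosure.intEquiv (𝓞 ℚ))
    rw [map_natCast, Int.isUnit_iff_natAbs_eq, Int.natAbs_natCast] at h
    exact hp.out.one_lt.ne' h
  obtain ⟨𝔪, h𝔪, hle⟩ := Ideal.exists_le_maximal _ hne
  have h𝔪0 : 𝔪 ≠ ⊥ := by
    intro h0
    rw [h0, le_bot_iff, Ideal.span_singleton_eq_bot] at hle
    exact (Nat.cast_ne_zero.2 hp.out.ne_zero) hle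
  exact ⟨⟨𝔪, h𝔪.isPrime, h𝔪0⟩, hle (Ideal.mem_span_singleton_self _)⟩

section Main

variable (W : WeierstrassCurve ℚ) [W.IsElliptic] [W.IsGloballyMinimal] (p : ℕ) [hp : Fact p.Prime] (κ : ZpExtension ℚ p)
  (hκ : κ.IsCyclotomic) (hord : IsOrdinaryAt W p)

include hκ hord in
/-- **`∃` a good place `v₀ ∤ p` with `H46(W, p, κ, v₀)` — UNCONDITIONALLY** (no (T₁), any rational `p`-torsion): for `E/ℚ` (globally minimal
`W`) with good ORDINARY reduction at `p`, `κ` the cyclotomic `ℤ_p`-extension and `Sel_{p^∞}(E/ℚ)` finite, there is a finite place `v₀`, good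
and prime to `p`, such that every `p`-power-torsion class `z ∈ H¹(Γ_{ℚ_{v₀}}, E(ℚ̄_{v₀}))` is realised: `∃ T ∈ H¹(ℚ_∞, E[p^∞])` all of whose
conjugates are Kummer at every finite `v ≠ v₀` and at `∞` and restrict at `v₀` to `z` — the hypothesis `h46` of the `…TorsionEulerCharFact`
doors. The assembly `H46Assembly.exists_realiser_of_sockets` at the deep layer `n*` of the B6 schedule with `Sp = S` (strict at `p`, unramified
at `S ∖ {p}`), `v₀` split in `ℚ_{n*}`, (HB6) = B6a ∘ `B6.exists_layer_cores_reduce_eq_zero` ∘ R2; see the module docstring.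
[cite: GreenbergLNM1716, §4 Lemma 4.6 (p. 105), Lemma 4.7 (p. 108)] [cite: MilneADT2006, Ch. I, Thm. 4.10] -/
theorem exists_lemma46 [Finite (W.selmerGroupPInfty p)] :
    ∃ v₀ : HeightOneSpectrum (𝓞 ℚ), ((p : ℕ) : 𝓞 ℚ) ∉ v₀.asIdeal ∧ W.HasGoodReductionAt v₀ ∧
      ∀ z : discreteH1 (localSubgroup (⊤ : Subgroup (absoluteGaloisGroup ℚ)) (v₀.adicCompletion ℚ))
        (localPoints W (v₀.adicCompletion ℚ)), (∃ k : ℕ, p ^ k • z = 0) →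
      ∃ T : W.subgroupH1 p κ.kerSubgroup,
        (∀ v : HeightOneSpectrum (𝓞 ℚ), v ≠ v₀ → ∀ σ : absoluteGaloisGroup ℚ,
          W.conjH1 p κ.kerSubgroup σ T ∈ W.localKerOver p κ.kerSubgroup (v.adicCompletion ℚ)) ∧
        (∀ (w : InfinitePlace ℚ) (σ : absoluteGaloisGroup ℚ),
          W.conjH1 p κ.kerSubgroup σ T ∈ W.localKerOver p κ.kerSubgroup w.Completion) ∧
        ∀ σ : absoluteGaloisGroup ℚ,
          W.localResOver p κ.kerSubgroup (v₀.adicCompletion ℚ) (W.conjH1 p κ.kerSubgroup σ T) =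
            Literature.NumberTheory.EllipticCurves.resOfLe (localPoints W (v₀.adicCompletion ℚ))
              (Subgroup.comap_mono le_top :
                localSubgroup κ.kerSubgroup (v₀.adicCompletion ℚ) ≤
                  localSubgroup (⊤ : Subgroup (absoluteGaloisGroup ℚ)) (v₀.adicCompletion ℚ)) z := by
  -- (0) the deep layer `n*` of the schedule; `S`; the place `vp ∋ p`; the split auxiliary place `v₀`
  obtain ⟨nstar, hn⟩ := B6.exists_layer_cores_reduce_eq_zero W p κ hκ hord
  obtain ⟨S, -, hS, -⟩ := exists_finset_place W p
  obtain ⟨vp, hvp⟩ := exists_place_natCast_mem p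
  have hvpS : vp ∈ S := by
    by_contra h
    exact (hS vp h).1 hvp
  have hgoodp : W.HasGoodReductionAt vp := (W.hasGoodReductionAt_and_hasUnitRootAt_of_rat hord.1 hord.2 vp hvp).1
  obtain ⟨v₀, hv₀, hsplit⟩ := H46SplitAuxPrime.exists_not_mem_localSubgroup_layerSubgroup_eq_top κ hκ nstar S (fun v hv ↦ (hS v hv).1)
  have hpv₀ : ((p : ℕ) : 𝓞 ℚ) ∉ v₀.asIdeal := (hS v₀ hv₀).1
  -- (1) R2: the uniform exponent `c'` at the layer `n*`; the schedule's `c`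
  obtain ⟨c', hc'⟩ := H46LayerSelmer.exists_pow_nsmul_push_mem_selmerInfty W p κ hκ nstar v₀ hpv₀ hsplit vp hvp hgoodp
  obtain ⟨c, hc⟩ := hn c'
  refine ⟨v₀, hpv₀, (hS v₀ hv₀).2, fun z hz ↦ ?_⟩
  obtain ⟨j, hj⟩ := hz
  -- instances (kept as `haveI`, the file declares none)
  haveI : CompactSpace (absoluteGaloisGroup ℚ) := absoluteGaloisGroup_compactSpace ℚ
  haveI : CompactSpace (absoluteGaloisGroup (v₀.adicCompletion ℚ)) := absoluteGaloisGroup_compactSpace _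
  haveI : Fintype (absoluteGaloisGroup ℚ ⧸ κ.layerSubgroup nstar) :=
    @Fintype.ofFinite _ (Subgroup.quotient_finite_of_isOpen _ (κ.isOpen_layerSubgroup nstar))
  obtain ⟨s, hs, hs1⟩ := exists_reps_one (κ.layerSubgroup nstar)
  -- good ordinary data at the places above `p`
  have hgood : ∀ v : HeightOneSpectrum (𝓞 ℚ), ((p : ℕ) : 𝓞 ℚ) ∈ v.asIdeal → W.HasGoodReductionAt v := fun v hv ↦
    (W.hasGoodReductionAt_and_hasUnitRootAt_of_rat hord.1 hord.2 v hv).1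
  have hordv : ∀ v : HeightOneSpectrum (𝓞 ℚ), ((p : ℕ) : 𝓞 ℚ) ∈ v.asIdeal → ¬ ((p : ℤ) ∣ W.frobeniusTraceAt v) := fun v hv ↦ by
    rw [W.frobeniusTraceAt_eq_frobeniusTrace v, Rat.HeightOneSpectrum.primesEquiv_eq_of_natCast_mem v hp.out hv]
    exact hord.2
  -- (2) lift `z` to `zt_j ∈ H¹(ℚ_{v₀}, E[p^j])`
  have hm : (((p ^ j : ℕ) : ℤ)) ≠ 0 := by exact_mod_cast pow_ne_zero j hp.out.ne_zero
  have hz' : ((p ^ j : ℕ) : ℤ) • z = 0 := by rw [natCast_zsmul]; exact hj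
  obtain ⟨ztj, hztj⟩ := @H46Assembly.exists_eq_resTop_kummer_of_zsmul_eq_zero ℚ _ _ W _ (v₀.adicCompletion ℚ) _ _
    (charZero_of_injective_algebraMap (algebraMap ℚ (v₀.adicCompletion ℚ)).injective) _ hm z hz'
  -- (3) the level `N = c + j + 1`
  have hjN : j ≤ c + j + 1 := by omega
  have hcN : c + j ≤ c + j + 1 := Nat.le_succ _
  haveI : NeZero (p ^ (c + j + 1)) := ⟨pow_ne_zero _ hp.out.ne_zero⟩
  haveI : Finite (W.geomTorsion ((p ^ (c + j + 1) : ℕ) : ℤ)) := finite_geomTorsion_of_neZero W (p ^ (c + j + 1))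
  haveI : Finite (W.geomTorsion ((p : ℤ) ^ (c + j + 1))) := by
    rw [← Nat.cast_pow]; exact finite_geomTorsion_of_neZero W (p ^ (c + j + 1))
  -- `ι : E[p^j] ↪ E[p^N]`, `r = p^{N-j} : E[p^N] → E[p^j]`
  have hdvd : ((p ^ j : ℕ) : ℤ) ∣ ((p ^ (c + j + 1) : ℕ) : ℤ) := Int.natCast_dvd_natCast.2 (pow_dvd_pow p hjN)
  have hι : ∀ P : W.geomTorsion ((p ^ j : ℕ) : ℤ),
      ((W.torsionInclusion hdvd P : W.geomTorsion ((p ^ (c + j + 1) : ℕ) : ℤ)) : W.geomPoints) = (P : W.geomPoints) := fun _ ↦ rfl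
  have hr : ∀ P : W.geomTorsion ((p ^ (c + j + 1) : ℕ) : ℤ),
      (((W.torsionGaloisModulePowReduce p (c + j + 1) j hjN :
          (W.torsionGaloisModule ((p ^ (c + j + 1) : ℕ) : ℤ)).toContRepresentation →ⁱL
            (W.torsionGaloisModule ((p ^ j : ℕ) : ℤ)).toContRepresentation) P : W.geomTorsion ((p ^ j : ℕ) : ℤ)) : W.geomPoints) =
        ((p ^ (c + j + 1 - j) : ℕ) : ℤ) • (P : W.geomPoints) := fun P ↦ by
    rw [Nat.cast_pow]; rfl
  -- `κ^{(N)} (ι_* zt_j) = κ^{(j)} zt_j`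
  have hkey : galoisCohomology.map (W.torsionPointsMapIntertwining ((p ^ (c + j + 1) : ℕ) : ℤ) (v₀.adicCompletion ℚ)) 1
      (cohomologyMap ((TopRep.resFunctor (absGaloisRestrict ℚ (v₀.adicCompletion ℚ) :
          absoluteGaloisGroup (v₀.adicCompletion ℚ) →* absoluteGaloisGroup ℚ)).map
        (toTopRepHom (W.torsionGaloisModule ((p ^ j : ℕ) : ℤ)) (W.torsionGaloisModule ((p ^ (c + j + 1) : ℕ) : ℤ))
          (W.torsionInclusion hdvd))) 1 ztj) =
      galoisCohomology.map (W.torsionPointsMapIntertwining ((p ^ j : ℕ) : ℤ) (v₀.adicCompletion ℚ)) 1 ztj :=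
    SignedEC.CasselsPT.map_torsionPointsMapIntertwining_map_torsionInclusion W (v₀.adicCompletion ℚ) hdvd ztj
  -- (4) the assembly at the layer `n*`, `Sp = S`
  obtain ⟨T, h1, h2, h3⟩ := H46Assembly.exists_realiser_of_sockets W p κ hκ nstar (c + j + 1) hs hs1 S S (Finset.Subset.refl S) hS v₀ hv₀
    -- (HP) `Lp`: Greenberg-strict layer classes at `p`, unramified at the other places of `S`
    (fun v => if ((p : ℕ) : 𝓞 ℚ) ∈ v.asIdeal then AddSubgroup.comap
      (cohomologyMap (coindFinPull (W.torsionGaloisModule ((p ^ (c + j + 1) : ℕ) : ℤ)).toTopRep (κ.layerSubgroup nstar)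
        (resGalOfEmb (closureEmb (K := ℚ) (v.adicCompletion ℚ)))
        (X' := localRepOf (W.torsionGaloisModule ((p ^ (c + j + 1) : ℕ) : ℤ)) v)
        (TopRep.ofHom ⟨ContinuousLinearMap.id ℤ (W.geomTorsion ((p ^ (c + j + 1) : ℕ) : ℤ)), fun _ => rfl⟩) (layerGroup κ v nstar)
        (fun _ h => h)) 1).hom.toLinearMap.toAddMonoidHom
      (AddSubgroup.map (layerShapiroOf (W.torsionGaloisModule ((p ^ (c + j + 1) : ℕ) : ℤ)) κ v nstar).toAddMonoidHom
        (cohomologyMap (subgroupRepMap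
          (ContinuousRep.mkQHom (GaloisRep.restrictField (v.adicCompletion ℚ) (W.torsionGaloisModule ((p ^ (c + j + 1) : ℕ) : ℤ)))
            (AddSubgroup.toIntSubmodule (W.kernelOfReductionLocalDatumTorsion ((p ^ (c + j + 1) : ℕ) : ℤ) v).plus)
            (H46AtP.plus_toIntSubmodule_le_comap W ((p ^ (c + j + 1) : ℕ) : ℤ) v)) (layerGroup κ v nstar)) 1).hom.toLinearMap.toAddMonoidHom.ker)
      else unramifiedSubgroup (GaloisRep.toLocal v
        ((W.torsionGaloisModule ((p ^ (c + j + 1) : ℕ) : ℤ)).coind (κ.layerSubgroup nstar) (κ.isOpen_layerSubgroup nstar))) 1)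
    -- `Λp`: strict at `p`, unramified (Shapiro lift) at the other places of `S`
    (fun v b => (((p : ℕ) : 𝓞 ℚ) ∈ v.asIdeal →
        b ∈ (W.kernelOfReductionLocalDatumTorsion ((p ^ (c + j + 1) : ℕ) : ℤ) v).strictKer (κ.layerSubgroup nstar)) ∧
      (((p : ℕ) : 𝓞 ℚ) ∉ v.asIdeal →
        galoisCohomology.localization ((W.torsionGaloisModule ((p ^ (c + j + 1) : ℕ) : ℤ)).coind (κ.layerSubgroup nstar)
            (κ.isOpen_layerSubgroup nstar)) (Sum.inr v) 1
            (shapiroLift (W.torsionGaloisModule ((p ^ (c + j + 1) : ℕ) : ℤ)).toTopRep (κ.layerSubgroup nstar)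
              (κ.isOpen_layerSubgroup nstar) hs hs1 b) ∈
          unramifiedSubgroup (GaloisRep.toLocal v
            ((W.torsionGaloisModule ((p ^ (c + j + 1) : ℕ) : ℤ)).coind (κ.layerSubgroup nstar) (κ.isOpen_layerSubgroup nstar))) 1))
    -- `hLdual`
    (fun v hv b hdual => by
      refine ⟨fun hpv => ?_, fun hpv => ?_⟩
      · rw [if_pos hpv] at hdual
        haveI : CompactSpace (absoluteGaloisGroup (v.adicCompletion ℚ)) := absoluteGaloisGroup_compactSpace _
        exact H46AtP.mem_strictKer_of_localization_coindTateDual_mem_dualLocalCondition W p κ hκ nstar (c + j + 1) hs hs1 v hpv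
          (hgood v hpv) (hordv v hpv) b hdual
      · rw [if_neg hpv] at hdual
        exact H46BadPlaces.localization_shapiroLift_mem_unramifiedSubgroup_of_coindTateDual_mem_dualLocalCondition W p κ nstar
          (c + j + 1) hs hs1 (Nat.succ_pos _) v hpv b hdual)
    -- `hP`
    (fun v hv b hb σ => by
      by_cases hpv : ((p : ℕ) : 𝓞 ℚ) ∈ v.asIdeal
      · rw [if_pos hpv] at hb
        haveI : CompactSpace (absoluteGaloisGroup (v.adicCompletion ℚ)) := absoluteGaloisGroup_compactSpace _
        exact H46AtP.conjH1_realiser_mem_localKerOver_of_localization_shapiroLift_mem W p κ hκ nstar (c + j + 1) hs hs1 v hpv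
          (hgood v hpv) b hb σ
      · rw [if_neg hpv] at hb
        exact H46BadPlaces.conjH1_realiser_mem_localKerOver_of_localization_shapiroLift_mem_unramified_of_not_mem W p κ hκ nstar
          (c + j + 1) hs hs1 v hpv b hb σ)
    -- `zt = ι_* zt_j`
    (cohomologyMap ((TopRep.resFunctor (absGaloisRestrict ℚ (v₀.adicCompletion ℚ) :
        absoluteGaloisGroup (v₀.adicCompletion ℚ) →* absoluteGaloisGroup ℚ)).map
      (toTopRepHom (W.torsionGaloisModule ((p ^ j : ℕ) : ℤ)) (W.torsionGaloisModule ((p ^ (c + j + 1) : ℕ) : ℤ))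
        (W.torsionInclusion hdvd))) 1 ztj)
    -- (HB6) = B6a ∘ schedule ∘ R2
    (fun b hunr hΛ =>
      H46Obstruction.canonical_cupProduct_incl_eq_zero_of_cores_reduce_eq_zero W p hjN (κ.layerSubgroup nstar)
        (κ.isOpen_layerSubgroup nstar) v₀ (W.torsionInclusion hdvd) hι _ hr ztj b
        (hc j (c + j + 1) hcN _ hr b
          (hc' (c + j + 1) hs hs1 b
            (fun w hw₀ hpw => by
              by_cases hwS : w ∈ S
              · exact (hΛ w hwS).2 hpw
              · exact hunr w hwS (fun h => hw₀ (Finset.mem_singleton.mp h)))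
            ((hΛ vp hvpS).1 hvp))))
  refine ⟨T, h1, h2, fun σ ↦ ?_⟩
  rw [h3 σ, ← hztj, hkey]

end Main

/-! ## Corollaries: the Euler-characteristic displays, every good ordinary `p` -/

section Corollaries

/-- **Greenberg's Thm. 4.1 display in `ℚ_p`, EVERY good ordinary `p` (`2` included), ANY rational `p`-torsion, UNCONDITIONALLY**:
`fE(0) · #E(ℚ)(p)² = u · p^{ord_p ∏ c_ℓ} · #Ẽ(𝔽_p)(p)² · #Sel_{p^∞}(E/ℚ)`, `u ∈ ℤ_pˣ` (`charValue_rankZero_of_lemma46` with `h46`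
discharged by `exists_lemma46`). [cite: GreenbergLNM1716, Thm. 4.1 (p. 102), §4 Lemmas 4.6–4.7 (pp. 105–108)] -/
theorem charValue_rankZero (p : ℕ) [hp : Fact p.Prime] (W : WeierstrassCurve ℚ) [W.IsGloballyMinimal] [W.IsElliptic]
    (hgo : Rank1Residual.GoodOrd W p) (κ : ZpExtension ℚ p) (hκ : κ.IsCyclotomic) {γ : absoluteGaloisGroup ℚ} (hγ : κ.IsTopGenerator γ)
    (D : W.SelmerDualData κ γ) [Finite (W.selmerGroupPInfty p)] (fE : IwasawaAlgebra p) (hf : D.charIdeal = Ideal.span {fE}) :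
    ∃ u : ℤ_[p]ˣ,
      ((PowerSeries.constantCoeff fE : ℤ_[p]) : ℚ_[p]) *
          (Nat.card (AddCommGroup.primaryComponent W.toAffine.Point p) : ℚ_[p]) ^ 2 =
        ((u : ℤ_[p]) : ℚ_[p]) * (p : ℚ_[p]) ^ (padicValNat p W.tamagawaProduct) *
          (Nat.card (AddCommGroup.primaryComponent
            ((integralModelInt W).map (Int.castRingHom (ZMod p))).toAffine.Point p) : ℚ_[p]) ^ 2 *
          (Nat.card (W.selmerGroupPInfty p) : ℚ_[p]) := by
  have hord : IsOrdinaryAt W p := hgo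
  obtain ⟨v₀, hpv₀, hgood₀, h46⟩ := exists_lemma46 W p κ hκ hord
  exact charValue_rankZero_of_lemma46 p W hgo κ hκ hγ D v₀ hpv₀ hgood₀ h46 fE hf

open Summit.BirchSwinnertonDyer.Rank1Residual.X5.O1 in
/-- **`X5.O1.TwoAdicEulerCharRankZero W 0` for EVERY globally minimal elliptic `W/ℚ`** — the PRINT binder `hEC` of the K4 TOWER doors
(`…KatoHalfPinch…`, `…TowerLambdaRank`) is a THEOREM: Greenberg's rank-`0` Euler-characteristic display at the good ordinary `2`, rational
`2`-torsion allowed, no (T₁) (`twoAdicEulerCharRankZero_of_lemma46` ∘ `exists_lemma46`).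
[cite: GreenbergLNM1716, Thm. 4.1 (p. 102), §4 Lemmas 4.6–4.7 (pp. 105–108)] -/
theorem twoAdicEulerCharRankZero (W : WeierstrassCurve ℚ) [W.IsElliptic] [W.IsGloballyMinimal] : TwoAdicEulerCharRankZero W 0 :=
  twoAdicEulerCharRankZero_of_lemma46 W fun hgo κ hκ hSel ↦ by
    haveI := hSel
    have hord : IsOrdinaryAt W 2 := hgo
    exact exists_lemma46 W 2 κ hκ hord

end Corollaries

end TorsionEulerChar.H46

end Summit.BirchSwinnertonDyer.BirchSwinnertonDyer.Theorems
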